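import Summits.AtomisticToContinuum.HydrodynamicLimit.Theorems.JParityClosureEmpiricalEnskogIdentity
import Literature.MathematicalPhysics.KineticTheory.EvenCollisionTubeFunctional
import Literature.MathematicalPhysics.KineticTheory.EvenStatTruncationBound
import HarnessLib

/-!
# Free collisional balance in `K_N` units (stub S3c-a `stub_freeCollisionalBalanceKN` of the line
# `preshock-kinetic-slaving`, crux `JParityClosure.EvenStressEnskog`, stmt-AtomisticToContinuum-13079)

Deterministic, pathwise statement.  For a `C¹` time weight `a`, a smooth space weight `b` on `𝕋³`
and ANY bounded velocity observable `c` (`|c| ≤ C_c`), the collision sum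
`K_N[a b Δc] = collisionSum σ N Φ τ (a ⊗ b) 1 Δc r z` (`EvenCollisionTubeFunctional`) of the balance
mark `Δc (n, v⁻, w⁻) = c(v⁺) − c(v⁻)`, `v⁺ = (reflectVel n (v⁻, w⁻)).1`, is `O(ε_N)` along every good
orbit whose initial instant is not a collision time:
`|K_N[a b Δc](z)| ≤ ε_N · C(a, b, C_c, τ) · (1 + (N+1)⁻¹ Σ_i ‖v_i‖²)`.

Proof.  (1) `collisionSum_balanceMark_eq`: unfolding `collisionSum`, the mark fed with the rescaled
normal `ε⁻¹ • n` and the pre-collisional pair `(v⁻, w⁻) = reflectVel n (v, w)` is `c(v) − c(v⁻)`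
(`reflectVel_smul`, `reflectVel_reflectVel`), and `collisionTimes ∩ Icc 0 τ = collisionTimes ∩ Ioc 0 τ`
as `0` is not a collision time; hence `K_N = ε ×` the right-hand side of the PROVED microscopic
Enskog identity `empiricalEnskog_identity` (route support `EmpiricalEnskogIdentity`) for `N + 1`
particles.  (2) Its left-hand (free-transport) side
`a(τ)⟨μ_τ, bc⟩ − a(0)⟨μ_0, bc⟩ − ∫_0^τ (a'⟨μ_s, bc⟩ + a⟨μ_s, (v·∇b)c⟩) ds` is bounded by sup norms of
`a, a'` on `[0, τ]`, of `b, ∂b` on the compact torus, by `C_c`, `τ` and the mean kinetic energy, which is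
conserved along good orbits (`HardSphereFlow.configEnergy_flow`); the empirical averages are finite
sums (`integral_empiricalMeasure`), `‖v‖ ≤ 1 + ‖v‖²`.

References: M. Pulvirenti, S. Simonella, A. Trushechkin, Kinet. Relat. Models 11 (2018) §2 (weak form
of Bogolyubov's microscopic Enskog equation); H. Spohn, *Large Scale Dynamics of Interacting
Particles* (1991), Part I §3.2.
-/

noncomputable section

open scoped BigOperators InnerProductSpace Topology ENNReal
open MeasureTheory Filter Set
open Literature.MathematicalPhysics.KineticTheory Literature.Analysis.FluidPDE
open Literature.Analysis.FunctionSpaces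

namespace Summit.AtomisticToContinuum.HydrodynamicLimit.Theorems.EvenStressEnskog

/-- **The collision sum of the balance mark is `ε` times the collision side of the microscopic Enskog
identity.**  Unfolding `collisionSum` for the weight `a ⊗ b`, `g ≡ 1` and the mark
`Δc (n, v⁻, w⁻) = c((reflectVel n (v⁻, w⁻)).1) − c(v⁻)`: the rescaled normal is harmless
(`reflectVel_smul`), the reflection is an involution (`reflectVel_reflectVel`), and the window
`Icc 0 τ` may be replaced by `Ioc 0 τ` because `0` is not a collision time. [folklore] -/
theorem collisionSum_balanceMark_eq {σ : ℝ} (hσ : 0 < σ) {N : ℕ}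
    (Φ : HardSphereFlow (Torus.geometry (Fin 3)) (hsDiameter σ N) (N + 1))
    {z : Config (N + 1) (Fin 3) T3}
    (h0 : (0 : ℝ) ∉ collisionTimes (Torus.geometry (Fin 3)) (hsDiameter σ N) (fun s => Φ.flow s z))
    (τ : ℝ) (a : ℝ → ℝ) (b : T3 → ℝ) (c : V3 → ℝ) (r : ℝ) :
    collisionSum σ N Φ τ (fun p => a p.1 * b p.2) (fun _ => 1)
        (fun q => c (reflectVel q.1 (q.2.1, q.2.2)).1 - c q.2.1) r z =
      hsDiameter σ N * (((N + 1 : ℕ) : ℝ)⁻¹ *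
        ∑ᶠ (s : ℝ) (_ : s ∈ collisionTimes (Torus.geometry (Fin 3)) (hsDiameter σ N)
          (fun s => Φ.flow s z) ∩ Ioc 0 τ), a s * ∑ i : Fin (N + 1), ∑ j : Fin (N + 1),
          (if i ≠ j ∧ ‖(Torus.geometry (Fin 3)).sepVec (Φ.flow s z i).1 (Φ.flow s z j).1‖ =
              hsDiameter σ N then
            b (Φ.flow s z i).1 * (c (Φ.flow s z i).2 -
              c (reflectVel ((Torus.geometry (Fin 3)).sepVec (Φ.flow s z i).1 (Φ.flow s z j).1)
                ((Φ.flow s z i).2, (Φ.flow s z j).2)).1)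
          else 0)) := by
  have hε : hsDiameter σ N ≠ 0 := (hsDiameter_pos hσ N).ne'
  have hset : collisionTimes (Torus.geometry (Fin 3)) (hsDiameter σ N) (fun s => Φ.flow s z) ∩
      Icc 0 τ = collisionTimes (Torus.geometry (Fin 3)) (hsDiameter σ N) (fun s => Φ.flow s z) ∩
      Ioc 0 τ := by
    ext s
    simp only [mem_inter_iff, mem_Icc, mem_Ioc]
    constructor
    · rintro ⟨hs, h0s, hsτ⟩
      refine ⟨hs, lt_of_le_of_ne h0s ?_, hsτ⟩
      rintro rfl
      exact h0 hs
    · rintro ⟨hs, h0s, hsτ⟩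
      exact ⟨hs, h0s.le, hsτ⟩
  dsimp only [collisionSum]
  rw [hset, Nat.cast_succ, div_eq_mul_inv, mul_assoc]
  congr 2
  refine finsum_mem_congr rfl fun s _ => ?_
  rw [Finset.mul_sum]
  refine Finset.sum_congr rfl fun i _ => ?_
  rw [Finset.mul_sum]
  refine Finset.sum_congr rfl fun j _ => ?_
  split_ifs
  · rw [Prod.mk.eta, reflectVel_smul (inv_ne_zero hε), reflectVel_reflectVel]
    ring
  · rw [mul_zero]

/-- **Abstract bound on the free-transport side.**  If `|a| ≤ A` and `|a'| ≤ A'` on `[0, τ]`,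
`|I| ≤ P` and `|J| ≤ Q` everywhere, then
`|a(τ) I(τ) − a(0) I(0) − ∫_{[0,τ]} (a' I + a J)| ≤ 2 A P + τ (A' P + A Q)` (the set integral is bounded by
`τ ×` the sup of the integrand, whether or not it is integrable). [folklore] -/
theorem abs_freeTransport_le {a I J : ℝ → ℝ} {τ A A' P Q : ℝ} (hτ : 0 ≤ τ)
    (hA : ∀ s ∈ Icc (0 : ℝ) τ, |a s| ≤ A) (hA' : ∀ s ∈ Icc (0 : ℝ) τ, |deriv a s| ≤ A')
    (hI : ∀ s, |I s| ≤ P) (hJ : ∀ s, |J s| ≤ Q) (hA0 : 0 ≤ A) (hA'0 : 0 ≤ A') :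
    |a τ * I τ - a 0 * I 0 - ∫ s in Icc (0 : ℝ) τ, (deriv a s * I s + a s * J s)| ≤
      2 * A * P + τ * (A' * P + A * Q) := by
  have h1 : |a τ * I τ| ≤ A * P := by
    rw [abs_mul]
    exact mul_le_mul (hA τ ⟨hτ, le_rfl⟩) (hI τ) (abs_nonneg _) hA0
  have h2 : |a 0 * I 0| ≤ A * P := by
    rw [abs_mul]
    exact mul_le_mul (hA 0 ⟨le_rfl, hτ⟩) (hI 0) (abs_nonneg _) hA0
  have h3 : |∫ s in Icc (0 : ℝ) τ, (deriv a s * I s + a s * J s)| ≤ τ * (A' * P + A * Q) := by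
    have h := norm_setIntegral_le_of_norm_le_const (μ := volume) (s := Icc (0 : ℝ) τ)
      (f := fun s => deriv a s * I s + a s * J s) (C := A' * P + A * Q) measure_Icc_lt_top
      (fun s hs => by
        rw [Real.norm_eq_abs]
        calc |deriv a s * I s + a s * J s|
            ≤ |deriv a s * I s| + |a s * J s| := abs_add_le _ _
          _ ≤ A' * P + A * Q := by
            rw [abs_mul, abs_mul]
            exact add_le_add (mul_le_mul (hA' s hs) (hI s) (abs_nonneg _) hA'0)
              (mul_le_mul (hA s hs) (hJ s) (abs_nonneg _) hA0))
    rw [Real.volume_real_Icc_of_le hτ, sub_zero, Real.norm_eq_abs] at h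
    linarith
  calc |a τ * I τ - a 0 * I 0 - ∫ s in Icc (0 : ℝ) τ, (deriv a s * I s + a s * J s)|
      ≤ |a τ * I τ - a 0 * I 0| + |∫ s in Icc (0 : ℝ) τ, (deriv a s * I s + a s * J s)| :=
        abs_sub _ _
    _ ≤ |a τ * I τ| + |a 0 * I 0| + |∫ s in Icc (0 : ℝ) τ, (deriv a s * I s + a s * J s)| := by
        gcongr
        exact abs_sub _ _
    _ ≤ A * P + A * P + τ * (A' * P + A * Q) := add_le_add (add_le_add h1 h2) h3
    _ = 2 * A * P + τ * (A' * P + A * Q) := by ring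

/-- **The empirical average of `b ⊗ c` is bounded by `‖b‖_∞ C_c`** (a finite average of `N + 1`
terms, `integral_empiricalMeasure`). [folklore] -/
theorem abs_integral_empirical_mul_le {N : ℕ} (w : Config (N + 1) (Fin 3) T3) {b : T3 → ℝ}
    {c : V3 → ℝ} {B Cc : ℝ} (hB : ∀ x, |b x| ≤ B) (hc : ∀ v, |c v| ≤ Cc) (hB0 : 0 ≤ B) :
    |∫ q, b q.1 * c q.2 ∂(empiricalMeasure w)| ≤ B * Cc := by
  rw [integral_empiricalMeasure, abs_mul, abs_inv, Nat.abs_cast]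
  have hN : ((N + 1 : ℕ) : ℝ) ≠ 0 := Nat.cast_ne_zero.2 (Nat.succ_ne_zero N)
  calc ((N + 1 : ℕ) : ℝ)⁻¹ * |∑ i, b (w i).1 * c (w i).2|
      ≤ ((N + 1 : ℕ) : ℝ)⁻¹ * ∑ _i : Fin (N + 1), B * Cc := by
        refine mul_le_mul_of_nonneg_left ((Finset.abs_sum_le_sum_abs _ _).trans
          (Finset.sum_le_sum fun i _ => ?_)) (inv_nonneg.2 (Nat.cast_nonneg _))
        rw [abs_mul]
        exact mul_le_mul (hB _) (hc _) (abs_nonneg _) hB0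
    _ = B * Cc := by
        rw [Finset.sum_const, Finset.card_univ, Fintype.card_fin, nsmul_eq_mul,
          inv_mul_cancel_left₀ hN]

/-- **The empirical average of `(v·∇b) c` is bounded by `‖Σ_k |∂_k b|‖_∞ C_c (1 + mean energy)`**
(`|v_k| ≤ ‖v‖ ≤ 1 + ‖v‖²`, finite average). [folklore] -/
theorem abs_integral_empirical_transport_le {N : ℕ} (w : Config (N + 1) (Fin 3) T3) {b : T3 → ℝ}
    {c : V3 → ℝ} {B' Cc : ℝ} (hB' : ∀ x, ∑ k : Fin 3, |Torus.partialDeriv k b x| ≤ B')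
    (hc : ∀ v, |c v| ≤ Cc) (hB'0 : 0 ≤ B') (hCc : 0 ≤ Cc) :
    |∫ q, (∑ k : Fin 3, q.2 k * Torus.partialDeriv k b q.1) * c q.2 ∂(empiricalMeasure w)| ≤
      B' * Cc * (1 + ((N : ℝ) + 1)⁻¹ * ∑ i, ‖(w i).2‖ ^ 2) := by
  rw [integral_empiricalMeasure, abs_mul, abs_inv, Nat.abs_cast]
  have hN : ((N + 1 : ℕ) : ℝ) ≠ 0 := Nat.cast_ne_zero.2 (Nat.succ_ne_zero N)
  -- pointwise bound on one particle
  have hpt : ∀ (x : T3) (v : V3),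
      |(∑ k : Fin 3, v k * Torus.partialDeriv k b x) * c v| ≤ B' * Cc * (1 + ‖v‖ ^ 2) := by
    intro x v
    have h1 : |∑ k : Fin 3, v k * Torus.partialDeriv k b x| ≤ ‖v‖ * B' := by
      calc |∑ k : Fin 3, v k * Torus.partialDeriv k b x|
          ≤ ∑ k : Fin 3, |v k * Torus.partialDeriv k b x| := Finset.abs_sum_le_sum_abs _ _
        _ ≤ ∑ k : Fin 3, ‖v‖ * |Torus.partialDeriv k b x| :=
            Finset.sum_le_sum fun k _ => by
              rw [abs_mul]
              refine mul_le_mul_of_nonneg_right ?_ (abs_nonneg _)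
              rw [← Real.norm_eq_abs]
              exact PiLp.norm_apply_le v k
        _ = ‖v‖ * ∑ k : Fin 3, |Torus.partialDeriv k b x| := (Finset.mul_sum _ _ _).symm
        _ ≤ ‖v‖ * B' := mul_le_mul_of_nonneg_left (hB' x) (norm_nonneg _)
    have h2 : ‖v‖ ≤ 1 + ‖v‖ ^ 2 := by nlinarith [sq_nonneg (‖v‖ - 1), norm_nonneg v]
    rw [abs_mul]
    calc |∑ k : Fin 3, v k * Torus.partialDeriv k b x| * |c v|
        ≤ ‖v‖ * B' * Cc := mul_le_mul h1 (hc v) (abs_nonneg _) (by positivity)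
      _ ≤ (1 + ‖v‖ ^ 2) * B' * Cc := by gcongr
      _ = B' * Cc * (1 + ‖v‖ ^ 2) := by ring
  calc ((N + 1 : ℕ) : ℝ)⁻¹ *
        |∑ i, (∑ k : Fin 3, (w i).2 k * Torus.partialDeriv k b (w i).1) * c (w i).2|
      ≤ ((N + 1 : ℕ) : ℝ)⁻¹ * ∑ i, B' * Cc * (1 + ‖(w i).2‖ ^ 2) :=
        mul_le_mul_of_nonneg_left ((Finset.abs_sum_le_sum_abs _ _).trans
          (Finset.sum_le_sum fun i _ => hpt _ _)) (inv_nonneg.2 (Nat.cast_nonneg _))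
    _ = B' * Cc * (1 + ((N : ℝ) + 1)⁻¹ * ∑ i, ‖(w i).2‖ ^ 2) := by
        rw [← Finset.mul_sum, Finset.sum_add_distrib, Finset.sum_const, Finset.card_univ,
          Fintype.card_fin, nsmul_eq_mul, mul_one, mul_left_comm, mul_add,
          inv_mul_cancel₀ hN, Nat.cast_succ]

/-- **Kinetic energy is conserved along good orbits**, in the form `Σ‖v_i(s)‖² = Σ‖v_i(0)‖²`
(`HardSphereFlow.configEnergy_flow`). [folklore] -/
theorem sum_norm_sq_flow_eq {ε : ℝ} {N : ℕ} (Φ : HardSphereFlow (Torus.geometry (Fin 3)) ε N)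
    {z : Config N (Fin 3) T3} (hz : z ∈ Φ.good) (s : ℝ) :
    ∑ i, ‖(Φ.flow s z i).2‖ ^ 2 = ∑ i, ‖(z i).2‖ ^ 2 := by
  have h := Φ.configEnergy_flow hz s
  unfold configEnergy at h
  exact mul_left_cancel₀ (inv_ne_zero two_ne_zero) h

/-- **Sup bound of a continuous real function on `[0, τ]`** (compactness), in `|·|` form. [folklore] -/
theorem exists_abs_le_of_continuous_Icc {f : ℝ → ℝ} (hf : Continuous f) (τ : ℝ) :
    ∃ A, ∀ s ∈ Icc (0 : ℝ) τ, |f s| ≤ A := by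
  obtain ⟨A, hA⟩ := isCompact_Icc.exists_bound_of_continuousOn (hf.continuousOn (s := Icc (0 : ℝ) τ))
  exact ⟨A, fun s hs => by rw [← Real.norm_eq_abs]; exact hA s hs⟩

/-- **Sup bounds of a smooth function and of its gradient on the compact torus.** [folklore] -/
theorem exists_abs_le_of_isSmooth {b : T3 → ℝ} (hb : Torus.IsSmooth b) :
    (∃ B, ∀ x, |b x| ≤ B) ∧ ∃ B', ∀ x, ∑ k : Fin 3, |Torus.partialDeriv k b x| ≤ B' := by
  constructor
  · obtain ⟨B, hB⟩ := isCompact_univ.exists_bound_of_continuousOn hb.continuous.continuousOn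
    exact ⟨B, fun x => by rw [← Real.norm_eq_abs]; exact hB x (mem_univ x)⟩
  · have hcont : Continuous fun x => ∑ k : Fin 3, |Torus.partialDeriv k b x| :=
      continuous_finsetSum _ fun k _ => (hb.partialDeriv k).continuous.abs
    obtain ⟨B', hB'⟩ := isCompact_univ.exists_bound_of_continuousOn hcont.continuousOn
    refine ⟨B', fun x => ?_⟩
    have h := hB' x (mem_univ x)
    rwa [Real.norm_eq_abs, abs_of_nonneg (Finset.sum_nonneg fun k _ => abs_nonneg _)] at h

/-- **S3c-a · FREE COLLISIONAL BALANCE IN `K_N` UNITS** (`FreeCollisionalBalanceKN` of the line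
`preshock-kinetic-slaving`): along every good orbit whose initial instant is not a collision time, the
collision sum of the balance mark `c(v⁺) − c(v⁻)` weighted by `a(s) b(x)` is
`≤ ε_N · C(a, b, C_c, τ) · (1 + (N+1)⁻¹ Σ‖v_i‖²)` in absolute value, uniformly in `σ, N, Φ, z, r`.
It is `ε ×` the PROVED microscopic Enskog identity (`empiricalEnskog_identity`,
`collisionSum_balanceMark_eq`), whose free-transport side is bounded by `abs_freeTransport_le` with the
sup norms of `a, a', b, ∇b`, the bound `C_c` and the conserved kinetic energy.
[cite: PulvirentiSimonellaTrushechkin2018, §2] -/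
theorem stub_freeCollisionalBalanceKN :
  ∀ (a : ℝ → ℝ), ContDiff ℝ 1 a → ∀ (b : T3 → ℝ), Literature.Analysis.FunctionSpaces.Torus.IsSmooth b →
  ∀ (c : V3 → ℝ) (Cc : ℝ), (∀ v, |c v| ≤ Cc) → ∀ τ : ℝ, 0 < τ →
  ∃ C : ℝ, ∀ σ : ℝ, 0 < σ → ∀ (N : ℕ) (Φ : HardSphereFlow (Torus.geometry (Fin 3)) (hsDiameter σ N) (N + 1)),
  ∀ z ∈ Φ.good, (0 : ℝ) ∉ collisionTimes (Torus.geometry (Fin 3)) (hsDiameter σ N) (fun s => Φ.flow s z) →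
  ∀ r : ℝ,
    |collisionSum σ N Φ τ (fun p => a p.1 * b p.2) (fun _ => 1)
        (fun q => c (reflectVel q.1 (q.2.1, q.2.2)).1 - c q.2.1) r z|
      ≤ hsDiameter σ N * C * (1 + ((N : ℝ) + 1)⁻¹ * ∑ i, ‖(z i).2‖ ^ 2) := by
  intro a ha b hb c Cc hc τ hτ
  obtain ⟨A, hA⟩ := exists_abs_le_of_continuous_Icc ha.continuous τ
  obtain ⟨A', hA'⟩ := exists_abs_le_of_continuous_Icc (ha.continuous_deriv le_rfl) τ
  obtain ⟨⟨B, hB⟩, ⟨B', hB'⟩⟩ := exists_abs_le_of_isSmooth hb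
  have hCc : 0 ≤ Cc := (abs_nonneg _).trans (hc 0)
  have hA0 : 0 ≤ A := (abs_nonneg _).trans (hA 0 ⟨le_rfl, hτ.le⟩)
  have hA'0 : 0 ≤ A' := (abs_nonneg _).trans (hA' 0 ⟨le_rfl, hτ.le⟩)
  have hB0 : 0 ≤ B := (abs_nonneg _).trans (hB 0)
  have hB'0 : 0 ≤ B' := (Finset.sum_nonneg fun k _ => abs_nonneg _).trans (hB' 0)
  refine ⟨2 * A * (B * Cc) + τ * (A' * (B * Cc) + A * (B' * Cc)), ?_⟩
  intro σ hσ N Φ z hz h0 r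
  set E : ℝ := ((N : ℝ) + 1)⁻¹ * ∑ i, ‖(z i).2‖ ^ 2 with hE
  have hE0 : 0 ≤ E := by positivity
  have hε : 0 < hsDiameter σ N := hsDiameter_pos hσ N
  rw [collisionSum_balanceMark_eq hσ Φ h0 τ a b c r, ← empiricalEnskog_identity Φ hz hτ.le ha hb c,
    abs_mul, abs_of_pos hε, mul_assoc]
  refine mul_le_mul_of_nonneg_left ?_ hε.le
  have hI : ∀ s, |∫ q, b q.1 * c q.2 ∂(empiricalMeasure (Φ.flow s z))| ≤ B * Cc := fun s =>
    abs_integral_empirical_mul_le _ hB hc hB0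
  have hJ : ∀ s, |∫ q, (∑ k : Fin 3, q.2 k * Torus.partialDeriv k b q.1) * c q.2
      ∂(empiricalMeasure (Φ.flow s z))| ≤ B' * Cc * (1 + E) := fun s => by
    have h := abs_integral_empirical_transport_le (Φ.flow s z) hB' hc hB'0 hCc
    rwa [sum_norm_sq_flow_eq Φ hz s] at h
  refine (abs_freeTransport_le hτ.le hA hA' hI hJ hA0 hA'0).trans ?_
  have h1 : 0 ≤ A * (B * Cc) * E := by positivity
  have h2 : 0 ≤ τ * (A' * (B * Cc)) * E := by positivity
  nlinarith [h1, h2]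

end Summit.AtomisticToContinuum.HydrodynamicLimit.Theorems.EvenStressEnskog

end
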